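import Mathlib.MeasureTheory.Measure.GiryMonad
import Literature.MathematicalPhysics.KineticTheory.InfiniteChainBoundaryRatioLimit
import Literature.MathematicalPhysics.KineticTheory.InfiniteChainGoodSetSymmetries
import Literature.MathematicalPhysics.KineticTheory.InfiniteChainGibbsNormalisable
import Literature.MathematicalPhysics.KineticTheory.InfiniteChainGibbsExistenceShift
import Literature.Probability.LatticeModels.GibbsSpecificationCofinal
import Mathlib.MeasureTheory.Constructions.Cylinders
import HarnessLib

/-!
# Uniqueness of the shift-invariant DLR state of a one-dimensional anharmonic chain — PROVED

Topic `Literature/MathematicalPhysics/KineticTheory`; theorems only (no definitions, no named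
facts). For the infinite nearest-neighbour oscillator chain `P : OscillatorChain` at temperature
`T > 0`, with `U`, `V` continuous, `V ≥ 0` even and `e^{-U/T} ∈ L¹` (e.g. the pinned anharmonic
chain `pinnedChain ω₂ lam β γ`, `ω₂ > 0`, `lam, β ≥ 0`), ANY TWO shift-invariant DLR Gibbs states
(`IsChainGibbsMeasure T` + `IsShiftInvariant`) COINCIDE. Proof (Cassandro–Olivieri–Pellegrinotti–
Presutti 1978, §3; Georgii 2011, Ch. 10–11; transfer operator + Perron–Frobenius–Jentzsch gap): by
the DLR equations the expectation of a window observable `F` is the `μ`-average of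
`γ_{Λ_n}(F | η)` over boundary conditions; by `exists_boundary_uniform_ratio_limit` this kernel is
within `ε` of a universal number `L_F` as soon as the two boundary spins lie in `{Φ ≥ δ}`; by shift
invariance the exceptional boundary conditions have probability `≤ 2 μ{Φ(η_0) < δ} → 0` as
`δ ↓ 0`; hence `μ(F) = L_F` for every shift-invariant DLR `μ`, and window cylinders separate
probability measures. No temperedness / superstability hypothesis is needed beyond shift
invariance (the one-site marginal is the same at every site).

* `measure_setOf_apply_mem_eq_of_isShiftInvariant` — `μ{η_i ∈ B} = μ{η_0 ∈ B}`;
* `dependsOn_indicator_cylinder'` — a cylinder indicator reads only the cylinder's sites;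
* `lintegral_toReal_eq_of_boundary_limit` — `μ(F) = L_F` for shift-invariant DLR `μ`;
* `eq_of_isChainGibbsMeasure_of_isShiftInvariant` (**main**) and its `pinnedChain` instance
  `eq_of_isChainGibbsMeasure_of_isShiftInvariant_pinnedChain`;
* `hasSuperstabilityEstimate_of_isShiftInvariant_pinnedChain` — consequently EVERY shift-invariant DLR
  state of the pinned chain is the transfer-operator Markov state and obeys Buttà–Marchioro's
  superstability estimate (2.3) (existence: `InfiniteChainGibbsExistenceShift`).

[cite: Georgii2011, Thm 10.25 and §11.1]
-/

noncomputable section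

open MeasureTheory Set Function Filter Topology Finset Literature.Probability.LatticeModels
open scoped ENNReal

namespace Literature.MathematicalPhysics.KineticTheory.HeatConduction

/-- **One-site events have site-independent probability under a shift-invariant state**:
`μ{η : η_i ∈ B} = μ{η : η_0 ∈ B}`. [folklore] -/
theorem measure_setOf_apply_mem_eq_of_isShiftInvariant {μ : Measure ChainConfig}
    (hμ : IsShiftInvariant μ) {B : Set (ℝ × ℝ)} (hB : MeasurableSet B) (i : ℤ) :
    μ {η | η i ∈ B} = μ {η | η 0 ∈ B} := by
  have hS : MeasurableSet {η : ChainConfig | η 0 ∈ B} := measurable_pi_apply 0 hB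
  have h := (hμ.measurePreserving_chainShift i).measure_preimage hS.nullMeasurableSet
  have hpre : (chainShift i) ⁻¹' {η : ChainConfig | η 0 ∈ B} = {η | η i ∈ B} := by
    ext η
    simp only [Set.mem_preimage, Set.mem_setOf_eq, chainShift_apply, zero_add]
  rw [hpre] at h
  exact h

/-- The indicator of a cylinder over `s` depends only on the coordinates in `s`. [folklore] -/
theorem dependsOn_indicator_cylinder' {S : Type*} (s : Finset ℤ) (B : Set (s → S)) (c : ℝ≥0∞) :
    DependsOn ((cylinder s B).indicator fun _ : ℤ → S => c) (s : Set ℤ) := by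
  intro σ σ' hσ
  have hres : s.restrict σ = s.restrict σ' := funext fun i => hσ i i.2
  by_cases hmem : σ ∈ cylinder s B
  · have hmem' : σ' ∈ cylinder s B := by
      rw [mem_cylinder] at hmem ⊢; rwa [← hres]
    rw [indicator_of_mem hmem, indicator_of_mem hmem']
  · have hmem' : σ' ∉ cylinder s B := by
      rw [mem_cylinder] at hmem ⊢; rwa [← hres]
    rw [indicator_of_notMem hmem, indicator_of_notMem hmem']

namespace OscillatorChain

variable (P : OscillatorChain)

/-- **The expectation of a window observable under a shift-invariant DLR state is the universal
boundary limit.** If `0 ≤ F ≤ 1` is measurable and `L` is a number such that the finite-volume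
kernels `γ_{\{c-n,…,d+n\}}(F | η)` are within `ε` of `L` for `n ≥ N₀(δ, ε)` whenever
`Φ(η_{c-n-1}), Φ(η_{d+n+1}) ≥ δ` (`Φ > 0` measurable), then `∫ F dμ = L` for every shift-invariant
DLR state `μ` at `T` (`T > 0`, `U`, `V` continuous, `V ≥ 0`, `e^{-U/T} ∈ L¹`, so that the
kernels are probability measures). [cite: Georgii2011, Thm 10.25 and §11.1] -/
theorem lintegral_toReal_eq_of_boundary_limit {T : ℝ} (hT : 0 < T)
    (hUc : Continuous P.U) (hVc : Continuous P.V) (hV0 : ∀ r, 0 ≤ P.V r)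
    (hUi : Integrable (fun q : ℝ => Real.exp (-T⁻¹ * P.U q)))
    {Φ : ℝ × ℝ → ℝ} (hΦm : Measurable Φ) (hΦpos : ∀ u, 0 < Φ u)
    {c d : ℤ} {F : ChainConfig → ℝ≥0∞} (hFm : Measurable F) (hF1 : ∀ σ, F σ ≤ 1) {L : ℝ}
    (hL : ∀ δ : ℝ, 0 < δ → ∀ ε : ℝ, 0 < ε → ∃ N₀ : ℕ, ∀ n : ℕ, N₀ ≤ n →
      ∀ η : ChainConfig, δ ≤ Φ (η (c - n - 1)) → δ ≤ Φ (η (d + n + 1)) →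
        |(∫⁻ σ, F σ ∂(P.chainSpecification T (Finset.Icc (c - n) (d + n)) η)).toReal - L| < ε)
    {μ : Measure ChainConfig} (hμ : P.IsChainGibbsMeasure T μ) (hS : IsShiftInvariant μ) :
    (∫⁻ σ, F σ ∂μ).toReal = L := by
  have hUm : Measurable P.U := hUc.measurable
  have hVm : Measurable P.V := hVc.measurable
  haveI : IsProbabilityMeasure μ := hμ.1
  have hB2 : P.CondB2 T := by
    refine P.condB2_of_integrable_exp_neg hT hUc hVc hV0 ?_
    have h : (fun q : ℝ => Real.exp (-P.U q / T)) = fun q => Real.exp (-T⁻¹ * P.U q) := by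
      funext q; congr 1; ring
    rw [h]; exact hUi
  -- the sets of bad boundary spins
  have hSm : ∀ (δ : ℝ) (i : ℤ), MeasurableSet {η : ChainConfig | Φ (η i) < δ} := fun δ i =>
    measurableSet_lt (hΦm.comp (measurable_pi_apply i)) measurable_const
  have hSshift : ∀ (δ : ℝ) (i : ℤ), μ {η : ChainConfig | Φ (η i) < δ} = μ {η | Φ (η 0) < δ} :=
    fun δ i => measure_setOf_apply_mem_eq_of_isShiftInvariant hS
      (measurableSet_Iio.preimage hΦm : MeasurableSet (Φ ⁻¹' Set.Iio δ)) i
  -- Step A: the bound for fixed `δ`, `ε`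
  have hbound : ∀ δ : ℝ, 0 < δ → ∀ ε : ℝ, 0 < ε →
      |(∫⁻ σ, F σ ∂μ).toReal - L| ≤ ε + (1 + |L|) * (2 * μ.real {η | Φ (η 0) < δ}) := by
    intro δ hδ ε hε
    obtain ⟨N₀, hN₀⟩ := hL δ hδ ε hε
    set Λ : Finset ℤ := Finset.Icc (c - N₀) (d + N₀) with hΛ
    set R : ChainConfig → ℝ≥0∞ := fun η => ∫⁻ σ, F σ ∂(P.chainSpecification T Λ η) with hR
    have hmeasA : ∀ A : Set ChainConfig, MeasurableSet A →
        Measurable fun η => P.chainSpecification T Λ η A := fun A hA =>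
      P.measurable_chainSpecification_apply hUm hVm T Λ hA
    have hDLR : ∫⁻ η, R η ∂μ = ∫⁻ σ, F σ ∂μ := lintegral_lintegral_eq_of_dlr hmeasA (hμ.2 Λ) hFm
    have hR1 : ∀ η, R η ≤ 1 := fun η => by
      haveI := hB2 Λ η
      calc R η ≤ ∫⁻ _, 1 ∂(P.chainSpecification T Λ η) := lintegral_mono fun σ => hF1 σ
        _ = 1 := by rw [lintegral_const, one_mul, measure_univ]
    have hRm : Measurable R :=
      (Measure.measurable_lintegral hFm).comp (Measure.measurable_of_measurable_coe _ hmeasA)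
    have hRtop : ∀ η, R η < ∞ := fun η => (hR1 η).trans_lt ENNReal.one_lt_top
    have hRr1 : ∀ η, (R η).toReal ≤ 1 := fun η =>
      ENNReal.toReal_le_of_le_ofReal zero_le_one (by rw [ENNReal.ofReal_one]; exact hR1 η)
    have hI : (∫⁻ σ, F σ ∂μ).toReal = ∫ η, (R η).toReal ∂μ := by
      rw [← hDLR, integral_toReal hRm.aemeasurable (Eventually.of_forall hRtop)]
    rw [hI]
    -- pointwise bound
    set S : Set ChainConfig := {η | Φ (η (c - N₀ - 1)) < δ} ∪ {η | Φ (η (d + N₀ + 1)) < δ} with hSdef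
    have hSmeas : MeasurableSet S := (hSm δ _).union (hSm δ _)
    have hpt : ∀ η, |(R η).toReal - L| ≤ ε + (1 + |L|) * S.indicator (1 : ChainConfig → ℝ) η := by
      intro η
      by_cases hη : η ∈ S
      · rw [indicator_of_mem hη, Pi.one_apply, mul_one]
        calc |(R η).toReal - L| ≤ |(R η).toReal| + |L| := abs_sub _ _
          _ ≤ 1 + |L| := by rw [abs_of_nonneg ENNReal.toReal_nonneg]; exact add_le_add (hRr1 η) le_rfl
          _ ≤ ε + (1 + |L|) := by linarith
      · rw [indicator_of_notMem hη, mul_zero, add_zero]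
        have h' : δ ≤ Φ (η (c - N₀ - 1)) ∧ δ ≤ Φ (η (d + N₀ + 1)) := by
          simpa only [hSdef, Set.mem_union, Set.mem_setOf_eq, not_or, not_lt] using hη
        exact (hN₀ N₀ le_rfl η h'.1 h'.2).le
    -- integrate the pointwise bound
    have hgm : Measurable fun η => |(R η).toReal - L| :=
      (hRm.ennreal_toReal.sub measurable_const).abs
    have hgint : Integrable (fun η => |(R η).toReal - L|) μ := by
      refine (integrable_const (1 + |L|)).mono' hgm.aestronglyMeasurable (Eventually.of_forall fun η => ?_)
      rw [Real.norm_eq_abs, abs_abs]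
      calc |(R η).toReal - L| ≤ |(R η).toReal| + |L| := abs_sub _ _
        _ ≤ 1 + |L| := by rw [abs_of_nonneg ENNReal.toReal_nonneg]; exact add_le_add (hRr1 η) le_rfl
    have hRint : Integrable (fun η => (R η).toReal) μ :=
      (integrable_const (1 : ℝ)).mono' hRm.ennreal_toReal.aestronglyMeasurable
        (Eventually.of_forall fun η => by
          rw [Real.norm_eq_abs, abs_of_nonneg ENNReal.toReal_nonneg]; exact hRr1 η)
    have hind1 : Integrable (fun η => (1 + |L|) * S.indicator (1 : ChainConfig → ℝ) η) μ :=
      ((integrable_const (1 : ℝ)).indicator hSmeas).const_mul _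
    have hind : Integrable (fun η => ε + (1 + |L|) * S.indicator (1 : ChainConfig → ℝ) η) μ :=
      (integrable_const ε).add hind1
    have hindint : ∫ η, S.indicator (1 : ChainConfig → ℝ) η ∂μ = μ.real S :=
      integral_indicator_one hSmeas
    calc |∫ η, (R η).toReal ∂μ - L| = |∫ η, ((R η).toReal - L) ∂μ| := by
          rw [integral_sub hRint (integrable_const L), integral_const, smul_eq_mul,
            probReal_univ, one_mul]
      _ ≤ ∫ η, |(R η).toReal - L| ∂μ := abs_integral_le_integral_abs
      _ ≤ ∫ η, (ε + (1 + |L|) * S.indicator (1 : ChainConfig → ℝ) η) ∂μ :=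
          integral_mono hgint hind hpt
      _ = ε + (1 + |L|) * μ.real S := by
          rw [integral_add (integrable_const ε) hind1, integral_const, smul_eq_mul, probReal_univ,
            one_mul, integral_const_mul, hindint]
      _ ≤ ε + (1 + |L|) * (2 * μ.real {η | Φ (η 0) < δ}) := by
          have h2 : μ.real S ≤ 2 * μ.real {η | Φ (η 0) < δ} := by
            calc μ.real S ≤ μ.real {η | Φ (η (c - N₀ - 1)) < δ} + μ.real {η | Φ (η (d + N₀ + 1)) < δ} :=
                  measureReal_union_le _ _
              _ = 2 * μ.real {η | Φ (η 0) < δ} := by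
                  rw [measureReal_def, measureReal_def, measureReal_def, hSshift δ (c - N₀ - 1),
                    hSshift δ (d + N₀ + 1)]; ring
          have hpos : 0 ≤ 1 + |L| := by positivity
          linarith [mul_le_mul_of_nonneg_left h2 hpos]
  -- Step B: `ε → 0`, then `δ ↓ 0`
  have hbound' : ∀ δ : ℝ, 0 < δ →
      |(∫⁻ σ, F σ ∂μ).toReal - L| ≤ (1 + |L|) * (2 * μ.real {η | Φ (η 0) < δ}) := fun δ hδ =>
    le_of_forall_pos_le_add fun ε hε => by linarith [hbound δ hδ ε hε]
  set Sm : ℕ → Set ChainConfig := fun m => {η | Φ (η 0) < 1 / ((m : ℝ) + 1)} with hSmdef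
  have hanti : Antitone Sm := by
    intro m m' hmm' η hη
    simp only [hSmdef, Set.mem_setOf_eq] at hη ⊢
    have h1 : (1 : ℝ) / ((m' : ℝ) + 1) ≤ 1 / ((m : ℝ) + 1) := by
      apply one_div_le_one_div_of_le
      · positivity
      · exact_mod_cast Nat.succ_le_succ hmm'
    exact hη.trans_le h1
  have hempty : ⋂ m, Sm m = ∅ := by
    refine Set.eq_empty_of_forall_notMem fun η hη => ?_
    rw [Set.mem_iInter] at hη
    obtain ⟨m, hm⟩ := exists_nat_one_div_lt (hΦpos (η 0))
    have h := hη m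
    simp only [hSmdef, Set.mem_setOf_eq] at h
    linarith
  have htend : Tendsto (fun m => μ (Sm m)) atTop (𝓝 0) := by
    have h := tendsto_measure_iInter_atTop (μ := μ) (fun m => (hSm _ 0).nullMeasurableSet) hanti
      ⟨0, measure_ne_top μ _⟩
    rwa [hempty, measure_empty] at h
  have htend' : Tendsto (fun m => (1 + |L|) * (2 * μ.real (Sm m))) atTop (𝓝 0) := by
    have h1 : Tendsto (fun m => μ.real (Sm m)) atTop (𝓝 0) := by
      have h := (ENNReal.tendsto_toReal ENNReal.zero_ne_top).comp htend
      rw [ENNReal.toReal_zero] at h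
      exact h
    have h2 := (h1.const_mul 2).const_mul (1 + |L|)
    rw [mul_zero, mul_zero] at h2
    exact h2
  have hle : |(∫⁻ σ, F σ ∂μ).toReal - L| ≤ 0 :=
    ge_of_tendsto' htend' fun m => hbound' _ (by positivity)
  have h0 : |(∫⁻ σ, F σ ∂μ).toReal - L| = 0 := le_antisymm hle (abs_nonneg _)
  rw [abs_eq_zero, sub_eq_zero] at h0
  exact h0

/-- **Uniqueness of the shift-invariant DLR state of the chain.** For `T > 0`, `U`, `V`
continuous, `V ≥ 0` even and `e^{-U/T} ∈ L¹`, any two DLR Gibbs states of the chain at `T` which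
are invariant under the lattice shift coincide (Cassandro–Olivieri–Pellegrinotti–Presutti 1978,
§3, for this class of unbounded-spin chains; Georgii 2011, Ch. 10–11: the two-sided stationary
Markov chain of the transfer operator is the unique translation-invariant Gibbs measure).
[cite: Georgii2011, Thm 10.25 and §11.1] -/
theorem eq_of_isChainGibbsMeasure_of_isShiftInvariant {T : ℝ} (hT : 0 < T)
    (hUc : Continuous P.U) (hVc : Continuous P.V) (hV0 : ∀ r, 0 ≤ P.V r)
    (hVe : ∀ r, P.V (-r) = P.V r)
    (hUi : Integrable (fun q : ℝ => Real.exp (-T⁻¹ * P.U q)))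
    {μ₁ μ₂ : Measure ChainConfig}
    (h₁ : P.IsChainGibbsMeasure T μ₁) (hS₁ : IsShiftInvariant μ₁)
    (h₂ : P.IsChainGibbsMeasure T μ₂) (hS₂ : IsShiftInvariant μ₂) : μ₁ = μ₂ := by
  obtain ⟨Φ, hΦm, hΦpos, hlim⟩ := P.exists_boundary_uniform_ratio_limit hT hUc hVc hV0 hVe hUi
  haveI : IsProbabilityMeasure μ₁ := h₁.1
  haveI : IsProbabilityMeasure μ₂ := h₂.1
  refine ext_of_generate_finite (measurableCylinders fun _ : ℤ => ℝ × ℝ)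
    generateFrom_measurableCylinders.symm isPiSystem_measurableCylinders (fun A hA => ?_)
    (by rw [measure_univ, measure_univ])
  obtain ⟨s, B, hB, rfl⟩ := (mem_measurableCylinders A).1 hA
  have hcyl : MeasurableSet (cylinder s B) := MeasurableSet.cylinder (α := fun _ : ℤ => ℝ × ℝ) _ hB
  -- a window `{a, …, b+1}` containing the sites of the cylinder
  set N : ℕ := s.sup Int.natAbs with hN
  set a : ℤ := -(N : ℤ) with ha
  set b : ℤ := -(N : ℤ) + ((2 * N : ℕ) : ℤ) with hb
  have hsub : s ⊆ Finset.Icc a b := subset_Icc_sup_natAbs s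
  set F : ChainConfig → ℝ≥0∞ := (cylinder s B).indicator 1 with hF
  have hFm : Measurable F := measurable_one.indicator hcyl
  have hFd : DependsOn F (↑(Finset.Icc a (b + 1)) : Set ℤ) := by
    refine DependsOn.mono ?_ (dependsOn_indicator_cylinder' (S := ℝ × ℝ) s B 1)
    exact Finset.coe_subset.2 (hsub.trans (Finset.Icc_subset_Icc le_rfl (by omega)))
  have hF1 : ∀ σ, F σ ≤ 1 := fun σ => by
    rw [hF]
    by_cases hσ : σ ∈ cylinder s B
    · rw [indicator_of_mem hσ, Pi.one_apply]
    · rw [indicator_of_notMem hσ]; exact zero_le_one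
  have hab : a < b + 1 := by rw [ha, hb]; push_cast; omega
  obtain ⟨L, hL⟩ := hlim a (b + 1) hab F hFm hFd hF1
  have e₁ := P.lintegral_toReal_eq_of_boundary_limit hT hUc hVc hV0 hUi hΦm hΦpos hFm hF1 hL h₁ hS₁
  have e₂ := P.lintegral_toReal_eq_of_boundary_limit hT hUc hVc hV0 hUi hΦm hΦpos hFm hF1 hL h₂ hS₂
  rw [hF, lintegral_indicator_one hcyl] at e₁ e₂
  exact (ENNReal.toReal_eq_toReal_iff' (measure_ne_top _ _) (measure_ne_top _ _)).1 (e₁.trans e₂.symm)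

/-- **Uniqueness of the shift-invariant DLR state of the pinned anharmonic chain**
`pinnedChain ω₂ lam β γ` (`U q = ω₂ q²/2 + lam q⁴/4`, `V r = r²/2 + β r⁴/4`; `ω₂ > 0`, `lam, β ≥ 0`)
at every `T > 0`. [cite: Georgii2011, Thm 10.25 and §11.1] -/
theorem eq_of_isChainGibbsMeasure_of_isShiftInvariant_pinnedChain {ω₂ lam β : ℝ} (γ : ℝ)
    (hω : 0 < ω₂) (hl : 0 ≤ lam) (hβ : 0 ≤ β) {T : ℝ} (hT : 0 < T) {μ₁ μ₂ : Measure ChainConfig}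
    (h₁ : (pinnedChain ω₂ lam β γ).IsChainGibbsMeasure T μ₁) (hS₁ : IsShiftInvariant μ₁)
    (h₂ : (pinnedChain ω₂ lam β γ).IsChainGibbsMeasure T μ₂) (hS₂ : IsShiftInvariant μ₂) :
    μ₁ = μ₂ := by
  refine (pinnedChain ω₂ lam β γ).eq_of_isChainGibbsMeasure_of_isShiftInvariant hT
    ?_ ?_ ?_ ?_ (integrable_exp_neg_pinning hT hω hl β γ) h₁ hS₁ h₂ hS₂
  · show Continuous fun q : ℝ => ω₂ * q ^ 2 / 2 + lam * q ^ 4 / 4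
    fun_prop
  · show Continuous fun r : ℝ => r ^ 2 / 2 + β * r ^ 4 / 4
    fun_prop
  · intro r
    show 0 ≤ r ^ 2 / 2 + β * r ^ 4 / 4
    positivity
  · intro r
    show (-r) ^ 2 / 2 + β * (-r) ^ 4 / 4 = r ^ 2 / 2 + β * r ^ 4 / 4
    ring

/-- **Every shift-invariant DLR state of the pinned anharmonic chain is superstable**: it coincides
with the (shift-invariant, BM-superstable) transfer-operator Markov state of
`exists_isChainGibbsMeasure_shiftInvariant_superstable_pinnedChain`, hence obeys Buttà–Marchioro's
estimate (2.3). [cite: Georgii2011, Thm 10.25 and §11.1] -/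
theorem hasSuperstabilityEstimate_of_isShiftInvariant_pinnedChain {ω₂ lam β : ℝ} (γ : ℝ)
    (hω : 0 < ω₂) (hl : 0 ≤ lam) (hβ : 0 ≤ β) {T : ℝ} (hT : 0 < T) {μ : Measure ChainConfig}
    (hμ : (pinnedChain ω₂ lam β γ).IsChainGibbsMeasure T μ) (hS : IsShiftInvariant μ) :
    (pinnedChain ω₂ lam β γ).HasSuperstabilityEstimate μ := by
  obtain ⟨μ₀, h₀, hS₀, hSS₀⟩ :=
    exists_isChainGibbsMeasure_shiftInvariant_superstable_pinnedChain γ hω hl hβ hT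
  rw [eq_of_isChainGibbsMeasure_of_isShiftInvariant_pinnedChain γ hω hl hβ hT hμ hS h₀ hS₀]
  exact hSS₀

end OscillatorChain

end Literature.MathematicalPhysics.KineticTheory.HeatConduction

end
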